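import Summits.FinalStateConjecture.FinalStateConjecture.Theorems.SwallowTheDatumKerrShieldedSettlesStubKerrVacuumAux3
import HarnessLib

/-!
# Kerr is Ricci-flat, algebra III: the Koszul form identities

Support file for the stub `stub_kerrVacuum` of line `tapered-temporal-collar` (crux
`stmt-FinalStateConjecture-10054`): the Kerr metric `g_{M,a} = η + 2H ℓ ⊗ ℓ` in ingoing
Kerr–Schild Cartesian coordinates is Ricci-flat for all real `M, a, r₀` (`Kerr.isRicciFlat`).
The pure algebra is done over six real variables `(a, M, x₁, x₂, r, c)`: at a point of the chart
with Kerr–Schild radius `r > 0` put `c = z/r` (`= cos θ`), so that the defining quartic of `r`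
reads `x₂² = (r² + a²)(1 − c²) − x₁²`, and `Σ = r² + a²c²`, `H = M r/Σ`,
`ℓ = (1, (r x₁ + a x₂)/(r² + a²), (r x₂ − a x₁)/(r² + a²), c)`.
This part proves that the product-rule expression `kzT` of the Koszul form equals the closed form
`kT` (64 rational identities modulo the quartic; tactic `kerr_alg`: clear denominators,
normalise, reduce the powers of `x₂` by the quartic, normalise). Kerr–Schild 1965, §2.

## References

* R. P. Kerr, *Gravitational field of a spinning mass as an example of algebraically special
  metrics*, Phys. Rev. Lett. 11 (1963) 237–238.
* R. P. Kerr, A. Schild, *A new class of vacuum solutions of the Einstein field equations*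
  (1965), §§2–3.
* M. Visser, *The Kerr spacetime: a brief introduction*, arXiv:0706.0622, (32)–(36).
* B. O'Neill, *The geometry of Kerr black holes* (1995), Ch. 2, Thm. 2.6.1.
-/

set_option linter.dupNamespace false
set_option linter.unusedSimpArgs false
set_option linter.unusedTactic false
set_option linter.unreachableTactic false
set_option linter.unnecessarySeqFocus false

noncomputable section

namespace Summit.FinalStateConjecture.FinalStateConjecture.Theorems.SwallowTheDatum.KerrShieldedSettles

namespace StubKerrVacuum

/-- `Ξ_{kl} = ∑ g^{iβ} ∂_i∂_β g_{kl}` in closed form. [cite: KerrSchild1965, §3] -/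
def xiT (a M x₁ x₂ r c : ℝ) : Fin 4 → Fin 4 → ℝ
  | 0, 0 => (24*a*a*M*M*r*r*c*c - 8*M*M*r*r*r*r) / ((r^2 + a^2*c^2)^4)
  | 0, 1 => (4*a*a*a*a*M*x₁*r*r*c*c*c*c + 4*a^(6:ℕ)*M*x₁*c*c*c*c + 24*a*a*M*M*x₁*r*r*r*c*c
      + 24*a*a*a*M*M*x₂*r*r*c*c - 4*M*x₁*r^(6:ℕ) - 8*M*M*x₁*r^(5:ℕ) - 8*a*M*M*x₂*r*r*r*r
      - 4*a*a*M*x₁*r*r*r*r) / ((r^2 + a^2*c^2)^4 * (r^2 + a^2))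
  | 0, 2 => (4*a*a*a*a*M*x₂*r*r*c*c*c*c + 4*a^(6:ℕ)*M*x₂*c*c*c*c
      + 24*a*a*M*M*x₂*r*r*r*c*c - 24*a*a*a*M*M*x₁*r*r*c*c - 4*M*x₂*r^(6:ℕ) - 8*M*M*x₂*r^(5:ℕ)
      + 8*a*M*M*x₁*r*r*r*r - 4*a*a*M*x₂*r*r*r*r) / ((r^2 + a^2*c^2)^4 * (r^2 + a^2))
  | 0, 3 => (4*a*a*a*a*M*r*c^(5:ℕ)
      + 24*a*a*M*M*r*r*c*c*c - 8*a*a*a*a*M*r*c*c*c - 4*M*r^(5:ℕ)*c - 8*M*M*r*r*r*r*c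
      - 8*a*a*M*r*r*r*c) / ((r^2 + a^2*c^2)^4)
  | 1, 0 => (4*a*a*a*a*M*x₁*r*r*c*c*c*c + 4*a^(6:ℕ)*M*x₁*c*c*c*c + 24*a*a*M*M*x₁*r*r*r*c*c
      + 24*a*a*a*M*M*x₂*r*r*c*c - 4*M*x₁*r^(6:ℕ) - 8*M*M*x₁*r^(5:ℕ) - 8*a*M*M*x₂*r*r*r*r
      - 4*a*a*M*x₁*r*r*r*r) / ((r^2 + a^2*c^2)^4 * (r^2 + a^2))
  | 1, 1 => (4*a^(6:ℕ)*M*r*r*r*c^(6:ℕ) + 4*a^(8:ℕ)*M*r*c^(6:ℕ) + 12*a*a*a*a*M*r^(5:ℕ)*c*c*c*c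
      + 4*a*a*a*a*M*x₁*x₁*r*r*r*c*c*c*c - 24*a*a*a*a*M*M*r*r*r*r*c*c*c*c
      + 12*a^(6:ℕ)*M*r*r*r*c*c*c*c + 12*a^(6:ℕ)*M*x₁*x₁*r*c*c*c*c - 24*a^(6:ℕ)*M*M*r*r*c*c*c*c
      + 8*a^(7:ℕ)*M*x₁*x₂*c*c*c*c + 12*a*a*M*r^(7:ℕ)*c*c - 8*a*a*M*x₁*x₁*r^(5:ℕ)*c*c
      + 8*a*a*M*M*r^(6:ℕ)*c*c + 24*a*a*M*M*x₁*x₁*r*r*r*r*c*c - 16*a*a*a*M*x₁*x₂*r*r*r*r*c*c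
      + 48*a*a*a*M*M*x₁*x₂*r*r*r*c*c + 12*a*a*a*a*M*r^(5:ℕ)*c*c + 8*a*a*a*a*M*x₁*x₁*r*r*r*c*c
      + 32*a*a*a*a*M*M*r*r*r*r*c*c - 24*a*a*a*a*M*M*x₁*x₁*r*r*c*c + 24*a^(6:ℕ)*M*M*r*r*c*c
      + 4*M*r^(9:ℕ) - 12*M*x₁*x₁*r^(7:ℕ) - 8*M*M*x₁*x₁*r^(6:ℕ) - 16*a*M*x₁*x₂*r^(6:ℕ)
      - 16*a*M*M*x₁*x₂*r^(5:ℕ) + 4*a*a*M*r^(7:ℕ) - 4*a*a*M*x₁*x₁*r^(5:ℕ) - 8*a*a*M*M*r^(6:ℕ)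
      + 8*a*a*M*M*x₁*x₁*r*r*r*r - 8*a*a*a*M*x₁*x₂*r*r*r*r - 8*a*a*a*a*M*M*r*r*r*r) / ((r^2
      + a^2*c^2)^4 * (r^2 + a^2)^2)
  | 1, 2 => (-4*a^(7:ℕ)*M*r*r*c^(6:ℕ) - 4*a^(9:ℕ)*M*c^(6:ℕ)
      + 8*a*a*a*M*r^(6:ℕ)*c*c*c*c - 24*a*a*a*M*M*r^(5:ℕ)*c*c*c*c
      + 4*a*a*a*a*M*x₁*x₂*r*r*r*c*c*c*c
      + 8*a^(5:ℕ)*M*r*r*r*r*c*c*c*c - 24*a^(5:ℕ)*M*M*r*r*r*c*c*c*c + 12*a^(6:ℕ)*M*x₁*x₂*r*c*c*c*c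
      + 4*a^(7:ℕ)*M*r*r*c*c*c*c - 8*a^(7:ℕ)*M*x₁*x₁*c*c*c*c + 4*a^(9:ℕ)*M*c*c*c*c
      + 8*a*M*r^(8:ℕ)*c*c + 8*a*M*M*r^(7:ℕ)*c*c - 8*a*a*M*x₁*x₂*r^(5:ℕ)*c*c
      + 24*a*a*M*M*x₁*x₂*r*r*r*r*c*c + 4*a*a*a*M*r^(6:ℕ)*c*c + 16*a*a*a*M*x₁*x₁*r*r*r*r*c*c
      + 32*a*a*a*M*M*r^(5:ℕ)*c*c - 48*a*a*a*M*M*x₁*x₁*r*r*r*c*c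
      + 8*a*a*a*a*M*x₁*x₂*r*r*r*c*c - 24*a*a*a*a*M*M*x₁*x₂*r*r*c*c - 4*a^(5:ℕ)*M*r*r*r*r*c*c
      + 24*a^(5:ℕ)*M*M*r*r*r*c*c - 12*M*x₁*x₂*r^(7:ℕ) - 8*M*M*x₁*x₂*r^(6:ℕ) - 8*a*M*r^(8:ℕ)
      + 16*a*M*x₁*x₁*r^(6:ℕ) - 8*a*M*M*r^(7:ℕ) + 16*a*M*M*x₁*x₁*r^(5:ℕ) - 4*a*a*M*x₁*x₂*r^(5:ℕ)
      + 8*a*a*M*M*x₁*x₂*r*r*r*r - 12*a*a*a*M*r^(6:ℕ)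
      + 8*a*a*a*M*x₁*x₁*r*r*r*r - 8*a*a*a*M*M*r^(5:ℕ) - 4*a^(5:ℕ)*M*r*r*r*r) / ((r^2
      + a^2*c^2)^4 * (r^2 + a^2)^2)
  | 1, 3 => (4*a*a*a*a*M*x₁*r*r*c^(5:ℕ) + 4*a^(6:ℕ)*M*x₁*c^(5:ℕ) - 8*a*a*M*x₁*r*r*r*r*c*c*c
      + 24*a*a*M*M*x₁*r*r*r*c*c*c - 8*a*a*a*M*x₂*r*r*r*c*c*c
      + 24*a*a*a*M*M*x₂*r*r*c*c*c - 8*a*a*a*a*M*x₁*r*r*c*c*c - 8*a^(5:ℕ)*M*x₂*r*c*c*c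
      - 12*M*x₁*r^(6:ℕ)*c - 8*M*M*x₁*r^(5:ℕ)*c - 8*a*M*x₂*r^(5:ℕ)*c - 8*a*M*M*x₂*r*r*r*r*c
      - 12*a*a*M*x₁*r*r*r*r*c - 8*a*a*a*M*x₂*r*r*r*c) / ((r^2 + a^2*c^2)^4 * (r^2 + a^2))
  | 2, 0 => (4*a*a*a*a*M*x₂*r*r*c*c*c*c + 4*a^(6:ℕ)*M*x₂*c*c*c*c
      + 24*a*a*M*M*x₂*r*r*r*c*c - 24*a*a*a*M*M*x₁*r*r*c*c - 4*M*x₂*r^(6:ℕ) - 8*M*M*x₂*r^(5:ℕ)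
      + 8*a*M*M*x₁*r*r*r*r - 4*a*a*M*x₂*r*r*r*r) / ((r^2 + a^2*c^2)^4 * (r^2 + a^2))
  | 2, 1 => (-4*a^(7:ℕ)*M*r*r*c^(6:ℕ) - 4*a^(9:ℕ)*M*c^(6:ℕ)
      + 8*a*a*a*M*r^(6:ℕ)*c*c*c*c - 24*a*a*a*M*M*r^(5:ℕ)*c*c*c*c
      + 4*a*a*a*a*M*x₁*x₂*r*r*r*c*c*c*c
      + 8*a^(5:ℕ)*M*r*r*r*r*c*c*c*c - 24*a^(5:ℕ)*M*M*r*r*r*c*c*c*c + 12*a^(6:ℕ)*M*x₁*x₂*r*c*c*c*c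
      + 4*a^(7:ℕ)*M*r*r*c*c*c*c - 8*a^(7:ℕ)*M*x₁*x₁*c*c*c*c + 4*a^(9:ℕ)*M*c*c*c*c
      + 8*a*M*r^(8:ℕ)*c*c + 8*a*M*M*r^(7:ℕ)*c*c - 8*a*a*M*x₁*x₂*r^(5:ℕ)*c*c
      + 24*a*a*M*M*x₁*x₂*r*r*r*r*c*c + 4*a*a*a*M*r^(6:ℕ)*c*c + 16*a*a*a*M*x₁*x₁*r*r*r*r*c*c
      + 32*a*a*a*M*M*r^(5:ℕ)*c*c - 48*a*a*a*M*M*x₁*x₁*r*r*r*c*c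
      + 8*a*a*a*a*M*x₁*x₂*r*r*r*c*c - 24*a*a*a*a*M*M*x₁*x₂*r*r*c*c - 4*a^(5:ℕ)*M*r*r*r*r*c*c
      + 24*a^(5:ℕ)*M*M*r*r*r*c*c - 12*M*x₁*x₂*r^(7:ℕ) - 8*M*M*x₁*x₂*r^(6:ℕ) - 8*a*M*r^(8:ℕ)
      + 16*a*M*x₁*x₁*r^(6:ℕ) - 8*a*M*M*r^(7:ℕ) + 16*a*M*M*x₁*x₁*r^(5:ℕ) - 4*a*a*M*x₁*x₂*r^(5:ℕ)
      + 8*a*a*M*M*x₁*x₂*r*r*r*r - 12*a*a*a*M*r^(6:ℕ)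
      + 8*a*a*a*M*x₁*x₁*r*r*r*r - 8*a*a*a*M*M*r^(5:ℕ) - 4*a^(5:ℕ)*M*r*r*r*r) / ((r^2
      + a^2*c^2)^4 * (r^2 + a^2)^2)
  | 2, 2 => (-4*a*a*a*a*M*r^(5:ℕ)*c^(6:ℕ) - 12*a^(6:ℕ)*M*r*r*r*c^(6:ℕ) - 8*a^(8:ℕ)*M*r*c^(6:ℕ)
      + 8*a*a*M*r^(7:ℕ)*c*c*c*c - 24*a*a*M*M*r^(6:ℕ)*c*c*c*c
      + 16*a*a*a*a*M*r^(5:ℕ)*c*c*c*c - 4*a*a*a*a*M*x₁*x₁*r*r*r*c*c*c*c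
      - 24*a*a*a*a*M*M*r*r*r*r*c*c*c*c
      + 20*a^(6:ℕ)*M*r*r*r*c*c*c*c - 12*a^(6:ℕ)*M*x₁*x₁*r*c*c*c*c - 8*a^(7:ℕ)*M*x₁*x₂*c*c*c*c
      + 12*a^(8:ℕ)*M*r*c*c*c*c + 12*M*r^(9:ℕ)*c*c + 8*M*M*r^(8:ℕ)*c*c + 20*a*a*M*r^(7:ℕ)*c*c
      + 8*a*a*M*x₁*x₁*r^(5:ℕ)*c*c + 32*a*a*M*M*r^(6:ℕ)*c*c - 24*a*a*M*M*x₁*x₁*r*r*r*r*c*c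
      + 16*a*a*a*M*x₁*x₂*r*r*r*r*c*c - 48*a*a*a*M*M*x₁*x₂*r*r*r*c*c
      + 16*a*a*a*a*M*r^(5:ℕ)*c*c - 8*a*a*a*a*M*x₁*x₁*r*r*r*c*c + 24*a*a*a*a*M*M*r*r*r*r*c*c
      + 24*a*a*a*a*M*M*x₁*x₁*r*r*c*c + 8*a^(6:ℕ)*M*r*r*r*c*c - 8*M*r^(9:ℕ)
      + 12*M*x₁*x₁*r^(7:ℕ) - 8*M*M*r^(8:ℕ) + 8*M*M*x₁*x₁*r^(6:ℕ) + 16*a*M*x₁*x₂*r^(6:ℕ)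
      + 16*a*M*M*x₁*x₂*r^(5:ℕ) - 12*a*a*M*r^(7:ℕ)
      + 4*a*a*M*x₁*x₁*r^(5:ℕ) - 8*a*a*M*M*r^(6:ℕ) - 8*a*a*M*M*x₁*x₁*r*r*r*r
      + 8*a*a*a*M*x₁*x₂*r*r*r*r - 4*a*a*a*a*M*r^(5:ℕ)) / ((r^2 + a^2*c^2)^4 * (r^2 + a^2)^2)
  | 2, 3 => (4*a*a*a*a*M*x₂*r*r*c^(5:ℕ) + 4*a^(6:ℕ)*M*x₂*c^(5:ℕ) - 8*a*a*M*x₂*r*r*r*r*c*c*c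
      + 24*a*a*M*M*x₂*r*r*r*c*c*c
      + 8*a*a*a*M*x₁*r*r*r*c*c*c - 24*a*a*a*M*M*x₁*r*r*c*c*c - 8*a*a*a*a*M*x₂*r*r*c*c*c
      + 8*a^(5:ℕ)*M*x₁*r*c*c*c - 12*M*x₂*r^(6:ℕ)*c - 8*M*M*x₂*r^(5:ℕ)*c + 8*a*M*x₁*r^(5:ℕ)*c
      + 8*a*M*M*x₁*r*r*r*r*c - 12*a*a*M*x₂*r*r*r*r*c + 8*a*a*a*M*x₁*r*r*r*c) / ((r^2
      + a^2*c^2)^4 * (r^2 + a^2))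
  | 3, 0 => (4*a*a*a*a*M*r*c^(5:ℕ)
      + 24*a*a*M*M*r*r*c*c*c - 8*a*a*a*a*M*r*c*c*c - 4*M*r^(5:ℕ)*c - 8*M*M*r*r*r*r*c
      - 8*a*a*M*r*r*r*c) / ((r^2 + a^2*c^2)^4)
  | 3, 1 => (4*a*a*a*a*M*x₁*r*r*c^(5:ℕ) + 4*a^(6:ℕ)*M*x₁*c^(5:ℕ) - 8*a*a*M*x₁*r*r*r*r*c*c*c
      + 24*a*a*M*M*x₁*r*r*r*c*c*c - 8*a*a*a*M*x₂*r*r*r*c*c*c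
      + 24*a*a*a*M*M*x₂*r*r*c*c*c - 8*a*a*a*a*M*x₁*r*r*c*c*c - 8*a^(5:ℕ)*M*x₂*r*c*c*c
      - 12*M*x₁*r^(6:ℕ)*c - 8*M*M*x₁*r^(5:ℕ)*c - 8*a*M*x₂*r^(5:ℕ)*c - 8*a*M*M*x₂*r*r*r*r*c
      - 12*a*a*M*x₁*r*r*r*r*c - 8*a*a*a*M*x₂*r*r*r*c) / ((r^2 + a^2*c^2)^4 * (r^2 + a^2))
  | 3, 2 => (4*a*a*a*a*M*x₂*r*r*c^(5:ℕ) + 4*a^(6:ℕ)*M*x₂*c^(5:ℕ) - 8*a*a*M*x₂*r*r*r*r*c*c*c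
      + 24*a*a*M*M*x₂*r*r*r*c*c*c
      + 8*a*a*a*M*x₁*r*r*r*c*c*c - 24*a*a*a*M*M*x₁*r*r*c*c*c - 8*a*a*a*a*M*x₂*r*r*c*c*c
      + 8*a^(5:ℕ)*M*x₁*r*c*c*c - 12*M*x₂*r^(6:ℕ)*c - 8*M*M*x₂*r^(5:ℕ)*c + 8*a*M*x₁*r^(5:ℕ)*c
      + 8*a*M*M*x₁*r*r*r*r*c - 12*a*a*M*x₂*r*r*r*r*c + 8*a*a*a*M*x₁*r*r*r*c) / ((r^2
      + a^2*c^2)^4 * (r^2 + a^2))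
  | 3, 3 => (4*a*a*a*a*M*r*c^(6:ℕ) - 8*a*a*M*r*r*r*c*c*c*c
      + 24*a*a*M*M*r*r*c*c*c*c - 12*a*a*a*a*M*r*c*c*c*c - 12*M*r^(5:ℕ)*c*c - 8*M*M*r*r*r*r*c*c
      - 8*a*a*M*r*r*r*c*c + 4*M*r^(5:ℕ)) / ((r^2 + a^2*c^2)^4)

/-- `T_{kl} = ∑ Γ^m_{il} Γ^i_{km}` in closed form. [cite: KerrSchild1965, §3] -/
def t4T (a M x₁ x₂ r c : ℝ) : Fin 4 → Fin 4 → ℝ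
  | 0, 0 => (2*a*a*a*a*M*M*c*c*c*c - 12*a*a*M*M*r*r*c*c + 2*M*M*r*r*r*r) / ((r^2 + a^2*c^2)^4)
  | 0, 1 => (2*a*a*a*a*M*M*x₁*r*c*c*c*c
      + 2*a^(5:ℕ)*M*M*x₂*c*c*c*c - 12*a*a*M*M*x₁*r*r*r*c*c - 12*a*a*a*M*M*x₂*r*r*c*c
      + 2*M*M*x₁*r^(5:ℕ) + 2*a*M*M*x₂*r*r*r*r) / ((r^2 + a^2*c^2)^4 * (r^2 + a^2))
  | 0, 2 => (2*a*a*a*a*M*M*x₂*r*c*c*c*c - 2*a^(5:ℕ)*M*M*x₁*c*c*c*c - 12*a*a*M*M*x₂*r*r*r*c*c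
      + 12*a*a*a*M*M*x₁*r*r*c*c + 2*M*M*x₂*r^(5:ℕ) - 2*a*M*M*x₁*r*r*r*r) / ((r^2
      + a^2*c^2)^4 * (r^2 + a^2))
  | 0, 3 => (2*a*a*a*a*M*M*c^(5:ℕ) - 12*a*a*M*M*r*r*c*c*c + 2*M*M*r*r*r*r*c) / ((r^2 + a^2*c^2)^4)
  | 1, 0 => (2*a*a*a*a*M*M*x₁*r*c*c*c*c
      + 2*a^(5:ℕ)*M*M*x₂*c*c*c*c - 12*a*a*M*M*x₁*r*r*r*c*c - 12*a*a*a*M*M*x₂*r*r*c*c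
      + 2*M*M*x₁*r^(5:ℕ) + 2*a*M*M*x₂*r*r*r*r) / ((r^2 + a^2*c^2)^4 * (r^2 + a^2))
  | 1, 1 => (-2*a^(6:ℕ)*M*M*r*r*c^(6:ℕ) - 2*a^(8:ℕ)*M*M*c^(6:ℕ) + 12*a*a*a*a*M*M*r*r*r*r*c*c*c*c
      + 2*a*a*a*a*M*M*x₁*x₁*r*r*c*c*c*c + 4*a^(5:ℕ)*M*M*x₁*x₂*r*c*c*c*c
      + 14*a^(6:ℕ)*M*M*r*r*c*c*c*c - 2*a^(6:ℕ)*M*M*x₁*x₁*c*c*c*c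
      + 2*a^(8:ℕ)*M*M*c*c*c*c - 2*a*a*M*M*r^(6:ℕ)*c*c - 12*a*a*M*M*x₁*x₁*r*r*r*r*c*c
      - 24*a*a*a*M*M*x₁*x₂*r*r*r*c*c - 14*a*a*a*a*M*M*r*r*r*r*c*c
      + 12*a*a*a*a*M*M*x₁*x₁*r*r*c*c - 12*a^(6:ℕ)*M*M*r*r*c*c + 2*M*M*x₁*x₁*r^(6:ℕ)
      + 4*a*M*M*x₁*x₂*r^(5:ℕ) + 2*a*a*M*M*r^(6:ℕ) - 2*a*a*M*M*x₁*x₁*r*r*r*r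
      + 2*a*a*a*a*M*M*r*r*r*r) / ((r^2 + a^2*c^2)^4 * (r^2 + a^2)^2)
  | 1, 2 => (-2*a^(5:ℕ)*M*M*r*r*r*c^(6:ℕ) - 2*a^(7:ℕ)*M*M*r*c^(6:ℕ)
      + 12*a*a*a*M*M*r^(5:ℕ)*c*c*c*c + 2*a*a*a*a*M*M*x₁*x₂*r*r*c*c*c*c
      + 14*a^(5:ℕ)*M*M*r*r*r*c*c*c*c - 4*a^(5:ℕ)*M*M*x₁*x₁*r*c*c*c*c
      - 2*a^(6:ℕ)*M*M*x₁*x₂*c*c*c*c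
      + 2*a^(7:ℕ)*M*M*r*c*c*c*c - 2*a*M*M*r^(7:ℕ)*c*c - 12*a*a*M*M*x₁*x₂*r*r*r*r*c*c
      - 14*a*a*a*M*M*r^(5:ℕ)*c*c + 24*a*a*a*M*M*x₁*x₁*r*r*r*c*c
      + 12*a*a*a*a*M*M*x₁*x₂*r*r*c*c - 12*a^(5:ℕ)*M*M*r*r*r*c*c + 2*M*M*x₁*x₂*r^(6:ℕ)
      + 2*a*M*M*r^(7:ℕ) - 4*a*M*M*x₁*x₁*r^(5:ℕ) - 2*a*a*M*M*x₁*x₂*r*r*r*r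
      + 2*a*a*a*M*M*r^(5:ℕ)) / ((r^2 + a^2*c^2)^4 * (r^2 + a^2)^2)
  | 1, 3 => (2*a*a*a*a*M*M*x₁*r*c^(5:ℕ)
      + 2*a^(5:ℕ)*M*M*x₂*c^(5:ℕ) - 12*a*a*M*M*x₁*r*r*r*c*c*c - 12*a*a*a*M*M*x₂*r*r*c*c*c
      + 2*M*M*x₁*r^(5:ℕ)*c + 2*a*M*M*x₂*r*r*r*r*c) / ((r^2 + a^2*c^2)^4 * (r^2 + a^2))
  | 2, 0 => (2*a*a*a*a*M*M*x₂*r*c*c*c*c - 2*a^(5:ℕ)*M*M*x₁*c*c*c*c - 12*a*a*M*M*x₂*r*r*r*c*c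
      + 12*a*a*a*M*M*x₁*r*r*c*c + 2*M*M*x₂*r^(5:ℕ) - 2*a*M*M*x₁*r*r*r*r) / ((r^2
      + a^2*c^2)^4 * (r^2 + a^2))
  | 2, 1 => (-2*a^(5:ℕ)*M*M*r*r*r*c^(6:ℕ) - 2*a^(7:ℕ)*M*M*r*c^(6:ℕ)
      + 12*a*a*a*M*M*r^(5:ℕ)*c*c*c*c + 2*a*a*a*a*M*M*x₁*x₂*r*r*c*c*c*c
      + 14*a^(5:ℕ)*M*M*r*r*r*c*c*c*c - 4*a^(5:ℕ)*M*M*x₁*x₁*r*c*c*c*c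
      - 2*a^(6:ℕ)*M*M*x₁*x₂*c*c*c*c
      + 2*a^(7:ℕ)*M*M*r*c*c*c*c - 2*a*M*M*r^(7:ℕ)*c*c - 12*a*a*M*M*x₁*x₂*r*r*r*r*c*c
      - 14*a*a*a*M*M*r^(5:ℕ)*c*c + 24*a*a*a*M*M*x₁*x₁*r*r*r*c*c
      + 12*a*a*a*a*M*M*x₁*x₂*r*r*c*c - 12*a^(5:ℕ)*M*M*r*r*r*c*c + 2*M*M*x₁*x₂*r^(6:ℕ)
      + 2*a*M*M*r^(7:ℕ) - 4*a*M*M*x₁*x₁*r^(5:ℕ) - 2*a*a*M*M*x₁*x₂*r*r*r*r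
      + 2*a*a*a*M*M*r^(5:ℕ)) / ((r^2 + a^2*c^2)^4 * (r^2 + a^2)^2)
  | 2, 2 => (-2*a*a*a*a*M*M*r*r*r*r*c^(6:ℕ) - 2*a^(6:ℕ)*M*M*r*r*c^(6:ℕ)
      + 12*a*a*M*M*r^(6:ℕ)*c*c*c*c
      + 14*a*a*a*a*M*M*r*r*r*r*c*c*c*c - 2*a*a*a*a*M*M*x₁*x₁*r*r*c*c*c*c
      - 4*a^(5:ℕ)*M*M*x₁*x₂*r*c*c*c*c + 2*a^(6:ℕ)*M*M*r*r*c*c*c*c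
      + 2*a^(6:ℕ)*M*M*x₁*x₁*c*c*c*c - 2*M*M*r^(8:ℕ)*c*c - 14*a*a*M*M*r^(6:ℕ)*c*c
      + 12*a*a*M*M*x₁*x₁*r*r*r*r*c*c
      + 24*a*a*a*M*M*x₁*x₂*r*r*r*c*c - 12*a*a*a*a*M*M*r*r*r*r*c*c - 12*a*a*a*a*M*M*x₁*x₁*r*r*c*c
      + 2*M*M*r^(8:ℕ) - 2*M*M*x₁*x₁*r^(6:ℕ) - 4*a*M*M*x₁*x₂*r^(5:ℕ) + 2*a*a*M*M*r^(6:ℕ)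
      + 2*a*a*M*M*x₁*x₁*r*r*r*r) / ((r^2 + a^2*c^2)^4 * (r^2 + a^2)^2)
  | 2, 3 => (2*a*a*a*a*M*M*x₂*r*c^(5:ℕ) - 2*a^(5:ℕ)*M*M*x₁*c^(5:ℕ) - 12*a*a*M*M*x₂*r*r*r*c*c*c
      + 12*a*a*a*M*M*x₁*r*r*c*c*c + 2*M*M*x₂*r^(5:ℕ)*c - 2*a*M*M*x₁*r*r*r*r*c) / ((r^2
      + a^2*c^2)^4 * (r^2 + a^2))
  | 3, 0 => (2*a*a*a*a*M*M*c^(5:ℕ) - 12*a*a*M*M*r*r*c*c*c + 2*M*M*r*r*r*r*c) / ((r^2 + a^2*c^2)^4)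
  | 3, 1 => (2*a*a*a*a*M*M*x₁*r*c^(5:ℕ)
      + 2*a^(5:ℕ)*M*M*x₂*c^(5:ℕ) - 12*a*a*M*M*x₁*r*r*r*c*c*c - 12*a*a*a*M*M*x₂*r*r*c*c*c
      + 2*M*M*x₁*r^(5:ℕ)*c + 2*a*M*M*x₂*r*r*r*r*c) / ((r^2 + a^2*c^2)^4 * (r^2 + a^2))
  | 3, 2 => (2*a*a*a*a*M*M*x₂*r*c^(5:ℕ) - 2*a^(5:ℕ)*M*M*x₁*c^(5:ℕ) - 12*a*a*M*M*x₂*r*r*r*c*c*c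
      + 12*a*a*a*M*M*x₁*r*r*c*c*c + 2*M*M*x₂*r^(5:ℕ)*c - 2*a*M*M*x₁*r*r*r*r*c) / ((r^2
      + a^2*c^2)^4 * (r^2 + a^2))
  | 3, 3 => (2*a*a*a*a*M*M*c^(6:ℕ) - 12*a*a*M*M*r*r*c*c*c*c + 2*M*M*r*r*r*r*c*c) / ((r^2
      + a^2*c^2)^4)

/-- The flat quadratic Koszul terms `¼ η^{mm} ∑_i η^{ii} K(∂_i,∂_{l},∂_m) K(∂_0,∂_m,∂_i)`
in closed form (`aaT0 l m`). [cite: KerrSchild1965, §3] -/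
def aaT0 (a M x₁ x₂ r c : ℝ) : Fin 4 → Fin 4 → ℝ
  | 0, 0 => (-3*a*a*M*M*r*r*c*c + a*a*a*a*M*M*c*c + M*M*r*r*r*r + a*a*M*M*r*r) / ((r^2 + a^2*c^2)^4)
  | 0, 1 => (a*a*a*a*M*M*c*c*c*c - 3*a*a*M*M*r*r*c*c + a*a*M*M*x₁*x₁*c*c - a*a*a*a*M*M*c*c
      + M*M*x₁*x₁*r*r - a*a*M*M*r*r) / ((r^2 + a^2*c^2)^4)
  | 0, 2 => (-a*a*M*M*r*r*c*c*c*c - M*M*r*r*r*r*c*c - 3*a*a*M*M*r*r*c*c - a*a*M*M*x₁*x₁*c*c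
      + M*M*r*r*r*r - M*M*x₁*x₁*r*r) / ((r^2 + a^2*c^2)^4)
  | 0, 3 => (a*a*M*M*r*r*c*c*c*c + a*a*a*a*M*M*c*c*c*c
      + M*M*r*r*r*r*c*c - 3*a*a*M*M*r*r*c*c) / ((r^2 + a^2*c^2)^4)
  | 1, 0 => (-2*a*a*M*M*x₁*r*r*r*c*c - 5*a*a*a*M*M*x₂*r*r*c*c + 4*a*a*a*a*M*M*x₁*r*c*c
      + a^(5:ℕ)*M*M*x₂*c*c + 2*M*M*x₁*r^(5:ℕ) + 3*a*M*M*x₂*r*r*r*r + a*a*a*M*M*x₂*r*r) / ((r^2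
      + a^2*c^2)^4 * (r^2 + a^2))
  | 1, 1 => (-2*a*a*a*a*M*M*x₁*r^(5:ℕ)*c*c*c*c - a^(5:ℕ)*M*M*x₂*r*r*r*r*c*c*c*c
      + 2*a^(6:ℕ)*M*M*x₁*r*r*r*c*c*c*c + 4*a^(8:ℕ)*M*M*x₁*r*c*c*c*c + a^(9:ℕ)*M*M*x₂*c*c*c*c
      + 2*a*a*M*M*x₁*r^(7:ℕ)*c*c - a*a*a*M*M*x₂*r^(6:ℕ)*c*c
      + a*a*a*M*M*x₁*x₁*x₂*r*r*r*r*c*c - 4*a*a*a*a*M*M*x₁*x₁*x₁*r*r*r*c*c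
      - 3*a^(5:ℕ)*M*M*x₂*r*r*r*r*c*c - 6*a^(5:ℕ)*M*M*x₁*x₁*x₂*r*r*c*c
      - 6*a^(6:ℕ)*M*M*x₁*r*r*r*c*c + 4*a^(6:ℕ)*M*M*x₁*x₁*x₁*r*c*c - 3*a^(7:ℕ)*M*M*x₂*r*r*c*c
      + a^(7:ℕ)*M*M*x₁*x₁*x₂*c*c - 4*a^(8:ℕ)*M*M*x₁*r*c*c - a^(9:ℕ)*M*M*x₂*c*c
      - 3*a*M*M*x₁*x₁*x₂*r^(6:ℕ) - 6*a*a*M*M*x₁*r^(7:ℕ)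
      + 8*a*a*M*M*x₁*x₁*x₁*r^(5:ℕ) - 3*a*a*a*M*M*x₂*r^(6:ℕ)
      + 6*a*a*a*M*M*x₁*x₁*x₂*r*r*r*r - 6*a*a*a*a*M*M*x₁*r^(5:ℕ) - 4*a^(5:ℕ)*M*M*x₂*r*r*r*r
      + a^(5:ℕ)*M*M*x₁*x₁*x₂*r*r - a^(7:ℕ)*M*M*x₂*r*r) / ((r^2 + a^2*c^2)^4 * (r^2 + a^2)^3)
  | 1, 2 => (-a*a*a*M*M*x₂*r^(6:ℕ)*c*c*c*c + 4*a*a*a*a*M*M*x₁*r^(5:ℕ)*c*c*c*c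
      + 2*a^(6:ℕ)*M*M*x₁*r*r*r*c*c*c*c + a^(7:ℕ)*M*M*x₂*r*r*c*c*c*c - 2*a^(8:ℕ)*M*M*x₁*r*c*c*c*c
      + 3*a*M*M*x₂*r^(8:ℕ)*c*c - 12*a*a*M*M*x₁*r^(7:ℕ)*c*c
      + 3*a*a*a*M*M*x₂*r^(6:ℕ)*c*c - a*a*a*M*M*x₁*x₁*x₂*r*r*r*r*c*c
      - 24*a*a*a*a*M*M*x₁*r^(5:ℕ)*c*c
      + 4*a*a*a*a*M*M*x₁*x₁*x₁*r*r*r*c*c - 3*a^(5:ℕ)*M*M*x₂*r*r*r*r*c*c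
      + 6*a^(5:ℕ)*M*M*x₁*x₁*x₂*r*r*c*c - 12*a^(6:ℕ)*M*M*x₁*r*r*r*c*c
      - 4*a^(6:ℕ)*M*M*x₁*x₁*x₁*r*c*c - 3*a^(7:ℕ)*M*M*x₂*r*r*c*c - a^(7:ℕ)*M*M*x₁*x₁*x₂*c*c
      - a*M*M*x₂*r^(8:ℕ) + 3*a*M*M*x₁*x₁*x₂*r^(6:ℕ)
      + 6*a*a*M*M*x₁*r^(7:ℕ) - 8*a*a*M*M*x₁*x₁*x₁*r^(5:ℕ) - 6*a*a*a*M*M*x₁*x₁*x₂*r*r*r*r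
      + 6*a*a*a*a*M*M*x₁*r^(5:ℕ) + a^(5:ℕ)*M*M*x₂*r*r*r*r - a^(5:ℕ)*M*M*x₁*x₁*x₂*r*r) / ((r^2
      + a^2*c^2)^4 * (r^2 + a^2)^3)
  | 1, 3 => (a*a*a*M*M*x₂*c*c*c*c - 3*a*M*M*x₂*r*r*c*c) / ((r^2 + a^2*c^2)^4)
  | 2, 0 => (-2*a*a*M*M*x₂*r*r*r*c*c + 5*a*a*a*M*M*x₁*r*r*c*c
      + 4*a*a*a*a*M*M*x₂*r*c*c - a^(5:ℕ)*M*M*x₁*c*c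
      + 2*M*M*x₂*r^(5:ℕ) - 3*a*M*M*x₁*r*r*r*r - a*a*a*M*M*x₁*r*r) / ((r^2 + a^2*c^2)^4 * (r^2
      + a^2))
  | 2, 1 => (5*a^(5:ℕ)*M*M*x₁*r*r*r*r*c*c*c*c + 2*a^(6:ℕ)*M*M*x₂*r*r*r*c*c*c*c
      + 4*a^(7:ℕ)*M*M*x₁*r*r*c*c*c*c
      + 2*a^(8:ℕ)*M*M*x₂*r*c*c*c*c - a^(9:ℕ)*M*M*x₁*c*c*c*c - 4*a*a*M*M*x₂*r^(7:ℕ)*c*c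
      - 5*a*a*a*M*M*x₁*r^(6:ℕ)*c*c - a*a*a*M*M*x₁*x₁*x₁*r*r*r*r*c*c
      - 12*a*a*a*a*M*M*x₂*r^(5:ℕ)*c*c - 4*a*a*a*a*M*M*x₁*x₁*x₂*r*r*r*c*c
      - 9*a^(5:ℕ)*M*M*x₁*r*r*r*r*c*c
      + 6*a^(5:ℕ)*M*M*x₁*x₁*x₁*r*r*c*c - 12*a^(6:ℕ)*M*M*x₂*r*r*r*c*c
      + 4*a^(6:ℕ)*M*M*x₁*x₁*x₂*r*c*c - 3*a^(7:ℕ)*M*M*x₁*r*r*c*c - a^(7:ℕ)*M*M*x₁*x₁*x₁*c*c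
      - 4*a^(8:ℕ)*M*M*x₂*r*c*c + a^(9:ℕ)*M*M*x₁*c*c - 2*a*M*M*x₁*r^(8:ℕ)
      + 3*a*M*M*x₁*x₁*x₁*r^(6:ℕ) - 2*a*a*M*M*x₂*r^(7:ℕ) + 8*a*a*M*M*x₁*x₁*x₂*r^(5:ℕ)
      + 3*a*a*a*M*M*x₁*r^(6:ℕ) - 6*a*a*a*M*M*x₁*x₁*x₁*r*r*r*r - 2*a*a*a*a*M*M*x₂*r^(5:ℕ)
      + 6*a^(5:ℕ)*M*M*x₁*r*r*r*r - a^(5:ℕ)*M*M*x₁*x₁*x₁*r*r + a^(7:ℕ)*M*M*x₁*r*r) / ((r^2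
      + a^2*c^2)^4 * (r^2 + a^2)^3)
  | 2, 2 => (a*a*a*M*M*x₁*r^(6:ℕ)*c*c*c*c
      + 2*a*a*a*a*M*M*x₂*r^(5:ℕ)*c*c*c*c - 4*a^(5:ℕ)*M*M*x₁*r*r*r*r*c*c*c*c
      + 2*a^(6:ℕ)*M*M*x₂*r*r*r*c*c*c*c - 5*a^(7:ℕ)*M*M*x₁*r*r*c*c*c*c - 3*a*M*M*x₁*r^(8:ℕ)*c*c
      - 6*a*a*M*M*x₂*r^(7:ℕ)*c*c + 3*a*a*a*M*M*x₁*r^(6:ℕ)*c*c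
      + a*a*a*M*M*x₁*x₁*x₁*r*r*r*r*c*c - 12*a*a*a*a*M*M*x₂*r^(5:ℕ)*c*c
      + 4*a*a*a*a*M*M*x₁*x₁*x₂*r*r*r*c*c
      + 15*a^(5:ℕ)*M*M*x₁*r*r*r*r*c*c - 6*a^(5:ℕ)*M*M*x₁*x₁*x₁*r*r*c*c
      - 6*a^(6:ℕ)*M*M*x₂*r*r*r*c*c - 4*a^(6:ℕ)*M*M*x₁*x₁*x₂*r*c*c + 9*a^(7:ℕ)*M*M*x₁*r*r*c*c
      + a^(7:ℕ)*M*M*x₁*x₁*x₁*c*c + 3*a*M*M*x₁*r^(8:ℕ) - 3*a*M*M*x₁*x₁*x₁*r^(6:ℕ)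
      + 2*a*a*M*M*x₂*r^(7:ℕ) - 8*a*a*M*M*x₁*x₁*x₂*r^(5:ℕ) + 6*a*a*a*M*M*x₁*x₁*x₁*r*r*r*r
      + 2*a*a*a*a*M*M*x₂*r^(5:ℕ) - 3*a^(5:ℕ)*M*M*x₁*r*r*r*r + a^(5:ℕ)*M*M*x₁*x₁*x₁*r*r) / ((r^2
      + a^2*c^2)^4 * (r^2 + a^2)^3)
  | 2, 3 => (-a*a*a*M*M*x₁*c*c*c*c + 3*a*M*M*x₁*r*r*c*c) / ((r^2 + a^2*c^2)^4)
  | 3, 0 => (-2*a*a*M*M*r*r*c*c*c + 2*a*a*a*a*M*M*c*c*c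
      + 2*M*M*r*r*r*r*c - 2*a*a*M*M*r*r*c) / ((r^2 + a^2*c^2)^4)
  | 3, 1 => (2*a^(6:ℕ)*M*M*r*r*c^(5:ℕ)
      + 2*a^(8:ℕ)*M*M*c^(5:ℕ) - 4*a*a*M*M*r^(6:ℕ)*c*c*c - 10*a*a*a*a*M*M*r*r*r*r*c*c*c
      - 2*a*a*a*a*M*M*x₁*x₁*r*r*c*c*c - 4*a^(5:ℕ)*M*M*x₁*x₂*r*c*c*c - 8*a^(6:ℕ)*M*M*r*r*c*c*c
      + 2*a^(6:ℕ)*M*M*x₁*x₁*c*c*c - 2*a^(8:ℕ)*M*M*c*c*c + 2*a*a*M*M*x₁*x₁*r*r*r*r*c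
      + 4*a*a*a*M*M*x₁*x₂*r*r*r*c + 2*a*a*a*a*M*M*r*r*r*r*c - 2*a*a*a*a*M*M*x₁*x₁*r*r*c
      + 2*a^(6:ℕ)*M*M*r*r*c) / ((r^2 + a^2*c^2)^4 * (r^2 + a^2)^2)
  | 3, 2 => (2*a*a*a*a*M*M*r*r*r*r*c^(5:ℕ)
      + 2*a^(6:ℕ)*M*M*r*r*c^(5:ℕ) - 6*a*a*M*M*r^(6:ℕ)*c*c*c - 12*a*a*a*a*M*M*r*r*r*r*c*c*c
      + 2*a*a*a*a*M*M*x₁*x₁*r*r*c*c*c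
      + 4*a^(5:ℕ)*M*M*x₁*x₂*r*c*c*c - 6*a^(6:ℕ)*M*M*r*r*c*c*c - 2*a^(6:ℕ)*M*M*x₁*x₁*c*c*c
      + 2*a*a*M*M*r^(6:ℕ)*c - 2*a*a*M*M*x₁*x₁*r*r*r*r*c - 4*a*a*a*M*M*x₁*x₂*r*r*r*c
      + 2*a*a*a*a*M*M*r*r*r*r*c + 2*a*a*a*a*M*M*x₁*x₁*r*r*c) / ((r^2 + a^2*c^2)^4 * (r^2 + a^2)^2)
  | 3, 3 => 0

end StubKerrVacuum

/-- **Registered sub-goal `stub_kerrVacuumT4Symm`** of stub `stub_kerrVacuum` (line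
`tapered-temporal-collar`): the quadratic Christoffel terms `T_{kl}` are symmetric (table of this
file).
[cite: KerrSchild1965, §3] -/
theorem stub_kerrVacuumT4Symm : ∀ (a M x₁ x₂ r c : ℝ) (k l : Fin 4),
    StubKerrVacuum.t4T a M x₁ x₂ r c k l = StubKerrVacuum.t4T a M x₁ x₂ r c l k :=
by
  intro a M x₁ x₂ r c k l
  fin_cases k <;> fin_cases l <;> rfl

end Summit.FinalStateConjecture.FinalStateConjecture.Theorems.SwallowTheDatum.KerrShieldedSettles
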